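import Mathlib
import Summits.Schanuel.Schanuel.Theses.RigidCore
import Summits.Schanuel.Schanuel.Theorems.RigidCoreMinimalCounterexampleInAclLogSector
import Summits.Schanuel.Schanuel.Theorems.RigidCoreMinimalCounterexampleInAclAclCriterion
import Summits.Schanuel.Schanuel.Theorems.RigidCoreMinimalCounterexampleInAclKernelTranslateRigid

/-!
# Kernel-translation rigidity OF THE MATE SET — crux stmt-Schanuel-0969 `RigidCore.MinimalCounterexampleInAcl`

Route `RigidCore`, crux (S*) `MinimalCounterexampleInAcl` (item stmt-Schanuel-0969), line `kernel-arithmetic-selection`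
(lead prover-line-stmt-Schanuel-0969-c4-0), `--supports stmt-Schanuel-0969`; registered stub
`rankTwo_mem_expAcl_or_kerTranslate_rigid`.

The landed KERNEL-TRANSLATION RIGIDITY (`stub_kernelTranslateRigid`, …KernelTranslateRigid.lean): for a first failure `x`
of rank `n`, `c ≠ 0` and `k ∈ ℤⁿ`, if the ℚ-relations of `(x, eˣ, c)` survive `x ↦ x + c·k` then `k = 0`.  This file reads
it in the line's vocabulary (`locusMates`, `kerTranslate`), with `c = 2πi`:

* `relations_transfer_of_transcendental`: in CASE A — `2πi` transcendental over `ℚ(x, eˣ)` — the relations of `(x, eˣ, 2πi)`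
  hold at every point of the ℚ-locus of `x` with the same exponentials (the `T`-coefficients of a relation are relations of
  `(x, eˣ)`: group by powers of `T` through `MvPolynomial.optionEquivLeft`);
* `kerTranslate_mem_locusMates_imp_eq_zero`, `locusMates_inter_range_kerTranslate`: hence in Case A no non-trivial kernel
  translate `x + 2πi·k` is a mate of `x` — `exp` is injective on the kernel-translate class of `x` inside `locusMates x`,
  at EVERY rank (the analysis-free core of branch finiteness, with the sharp bound `1`);
* `rankTwo_mem_expAcl_or_kerTranslate_rigid`: at rank 2 Case B (`2πi` algebraic over `ℚ(x, eˣ)`) is settled by the landed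
  acl-criterion (`firstFailure_two_mem_expAcl_of_isAlgebraic_twoPiI`), so a rank-2 first failure OUTSIDE `acl(∅)²` — a
  counterexample to (S*) — has a trivial kernel-translate class.
-/

noncomputable section

set_option linter.dupNamespace false

open Complex Set

namespace Summit.Schanuel.Schanuel.Cruxes.MinimalCounterexampleInAcl.KernelArithmeticSelection

open Literature.NumberTheory.Transcendental (SchanuelRank)
open Summit.Schanuel.Schanuel.Theorems.AclSubsetLogFreeCore.Negative

variable {n : ℕ}

/-! ## Grouping a relation of `(v, a)` by powers of the last variable -/

section Grouping

variable {σ : Type}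

/-- Evaluating a polynomial in `σ ⊕ Unit` at `(v, a)` = evaluating its `T`-EXPANSION (the one-variable polynomial over `ℚ[σ]`
obtained through `optionEquivLeft` after renaming `σ ⊕ Unit ≃ Option σ`), with coefficients evaluated at `v`, at `T = a`. [folklore] -/
theorem aeval_sumElim_eq_eval_tExpand (v : σ → ℂ) (a : ℂ) (p : MvPolynomial (σ ⊕ Unit) ℚ) :
    MvPolynomial.aeval (Sum.elim v (fun _ : Unit => a)) p =
      Polynomial.eval a ((MvPolynomial.optionEquivLeft ℚ _ (MvPolynomial.rename (Equiv.optionEquivSumPUnit _).symm p)).map (MvPolynomial.aeval v : MvPolynomial σ ℚ →ₐ[ℚ] ℂ).toRingHom) := by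
  -- both sides are ring homomorphisms in `p` agreeing on constants and variables
  set F : MvPolynomial (σ ⊕ Unit) ℚ →+* ℂ :=
    ((Polynomial.evalRingHom a).comp
      ((Polynomial.mapRingHom (MvPolynomial.aeval v : MvPolynomial σ ℚ →ₐ[ℚ] ℂ).toRingHom).comp
        ((MvPolynomial.optionEquivLeft ℚ σ).toAlgHom.toRingHom.comp
          (MvPolynomial.rename (Equiv.optionEquivSumPUnit σ).symm : _ →ₐ[ℚ] _).toRingHom))) with hF
  have hFp : F p = Polynomial.eval a ((MvPolynomial.optionEquivLeft ℚ _ (MvPolynomial.rename (Equiv.optionEquivSumPUnit _).symm p)).map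
      (MvPolynomial.aeval v : MvPolynomial σ ℚ →ₐ[ℚ] ℂ).toRingHom) := rfl
  have hG : (MvPolynomial.aeval (Sum.elim v (fun _ : Unit => a)) : MvPolynomial (σ ⊕ Unit) ℚ →ₐ[ℚ] ℂ).toRingHom
      = F := by
    refine MvPolynomial.ringHom_ext (fun r => ?_) (fun i => ?_)
    · simp [hF, MvPolynomial.algebraMap_eq]
    · rcases i with i | u
      · simp [hF, MvPolynomial.optionEquivLeft_X_some]
      · simp [hF, MvPolynomial.optionEquivLeft_X_none]
  rw [← hFp, ← hG]
  rfl

/-- If `a` is transcendental over a subfield `K ∋ v i`, a ℚ-relation of `(v, a)` has all its `T`-coefficients vanishing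
at `v`. [folklore] -/
theorem aeval_coeff_tExpand_eq_zero {K : IntermediateField ℚ ℂ} {v : σ → ℂ} (hv : ∀ i, v i ∈ K) {a : ℂ}
    (ha : Transcendental K a) {p : MvPolynomial (σ ⊕ Unit) ℚ}
    (hp : MvPolynomial.aeval (Sum.elim v (fun _ : Unit => a)) p = 0) (j : ℕ) :
    MvPolynomial.aeval v ((MvPolynomial.optionEquivLeft ℚ _ (MvPolynomial.rename (Equiv.optionEquivSumPUnit _).symm p)).coeff j) = 0 := by
  -- the `T`-expansion with coefficients in `K`
  set vK : σ → K := fun i => ⟨v i, hv i⟩ with hvK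
  set Q : Polynomial K := (MvPolynomial.optionEquivLeft ℚ _ (MvPolynomial.rename (Equiv.optionEquivSumPUnit _).symm p)).map (MvPolynomial.aeval vK : MvPolynomial σ ℚ →ₐ[ℚ] K).toRingHom with hQ
  have hcoe : (algebraMap K ℂ).comp (MvPolynomial.aeval vK : MvPolynomial σ ℚ →ₐ[ℚ] K).toRingHom =
      (MvPolynomial.aeval v : MvPolynomial σ ℚ →ₐ[ℚ] ℂ).toRingHom := by
    refine MvPolynomial.ringHom_ext (fun r => ?_) (fun i => ?_)
    · simp
    · simp [hvK]
  have hQmap : Q.map (algebraMap K ℂ) =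
      (MvPolynomial.optionEquivLeft ℚ _ (MvPolynomial.rename (Equiv.optionEquivSumPUnit _).symm p)).map (MvPolynomial.aeval v : MvPolynomial σ ℚ →ₐ[ℚ] ℂ).toRingHom := by
    rw [hQ, Polynomial.map_map, hcoe]
  have hQa : Polynomial.aeval a Q = 0 := by
    rw [Polynomial.aeval_def, Polynomial.eval₂_eq_eval_map, hQmap, ← aeval_sumElim_eq_eval_tExpand, hp]
  have hQ0 : Q = 0 := by
    by_contra hne
    exact ha ⟨Q, hne, hQa⟩
  have hcoeff : Q.coeff j = 0 := by rw [hQ0, Polynomial.coeff_zero]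
  rw [hQ, Polynomial.coeff_map] at hcoeff
  have := congrArg (algebraMap K ℂ) hcoeff
  rw [map_zero] at this
  rw [← this]
  change _ = ((algebraMap K ℂ).comp (MvPolynomial.aeval vK : MvPolynomial σ ℚ →ₐ[ℚ] K).toRingHom) _
  rw [hcoe]
  rfl

end Grouping

/-! ## Corollaries in the line's vocabulary: Case A (`2πi` transcendental over `ℚ(x, eˣ)`) -/

/-- **In CASE A the relations of `(x, eˣ, c)` transfer to `(x', eˣ, c)` for every point `x'` of the locus of `x` with the
same exponentials** (`c` transcendental over `ℚ(x, eˣ)`): the `T`-coefficients of a relation are relations of `(x, eˣ)`.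
[folklore] -/
theorem relations_transfer_of_transcendental {x x' : Fin n → ℂ} {c : ℂ}
    (hc : Transcendental (IntermediateField.adjoin ℚ (range x ∪ range (cexp ∘ x))) c)
    (hexp : cexp ∘ x' = cexp ∘ x) (hrel : x' ∈ locusPts x) :
    ∀ p : MvPolynomial ((Fin n ⊕ Fin n) ⊕ Unit) ℚ,
      MvPolynomial.aeval (Sum.elim (Sum.elim x (cexp ∘ x)) (fun _ : Unit => c)) p = 0 →
      MvPolynomial.aeval (Sum.elim (Sum.elim x' (cexp ∘ x)) (fun _ : Unit => c)) p = 0 := by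
  intro p hp
  have hv : ∀ i : Fin n ⊕ Fin n, Sum.elim x (cexp ∘ x) i ∈ IntermediateField.adjoin ℚ (range x ∪ range (cexp ∘ x)) := by
    intro i
    refine IntermediateField.subset_adjoin ℚ _ ?_
    rcases i with i | i
    · exact Or.inl ⟨i, rfl⟩
    · exact Or.inr ⟨i, rfl⟩
  have hcoeff : ∀ j, MvPolynomial.aeval (Sum.elim x' (cexp ∘ x)) ((MvPolynomial.optionEquivLeft ℚ _ (MvPolynomial.rename (Equiv.optionEquivSumPUnit _).symm p)).coeff j) = 0 := by
    intro j
    have h0 := aeval_coeff_tExpand_eq_zero hv hc hp j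
    have h1 := hrel _ h0
    rwa [hexp] at h1
  rw [aeval_sumElim_eq_eval_tExpand, Polynomial.eval_map, Polynomial.eval₂_eq_sum_range]
  refine Finset.sum_eq_zero fun j _ => ?_
  change (MvPolynomial.aeval (Sum.elim x' (cexp ∘ x))) ((MvPolynomial.optionEquivLeft ℚ _ (MvPolynomial.rename (Equiv.optionEquivSumPUnit _).symm p)).coeff j) * c ^ j = 0
  rw [hcoeff j, zero_mul]

/-- **KERNEL-TRANSLATION RIGIDITY OF THE MATE SET IN CASE A**: if `2πi` is transcendental over `ℚ(x, eˣ)` for a first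
failure `x` (the only case open at rank 2, `firstFailure_two_mem_expAcl_of_isAlgebraic_twoPiI`), then NO non-trivial kernel
translate `x + 2πi·k` of `x` is a mate of `x`: on the kernel-translate class of `x` the exponential map is injective on
`locusMates x`. [folklore] -/
theorem kerTranslate_mem_locusMates_imp_eq_zero {x : Fin n → ℂ} (hx : x ∈ firstFailures n)
    (hπ : Transcendental (IntermediateField.adjoin ℚ (range x ∪ range (cexp ∘ x))) (2 * ↑Real.pi * I))
    {k : Fin n → ℤ} (hk : kerTranslate x k ∈ locusMates x) : k = 0 := by
  have h2πi : (2 * ↑Real.pi * I : ℂ) ≠ 0 := by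
    simp [Real.pi_ne_zero, Complex.I_ne_zero]
  refine stub_kernelTranslateRigid n x (2 * ↑Real.pi * I) k hx h2πi ?_
  have hexp : cexp ∘ kerTranslate x k = cexp ∘ x := cexp_comp_kerTranslate x k
  have htr := relations_transfer_of_transcendental hπ hexp hk.2
  intro p hp
  have h := htr p hp
  have hfun : (fun i => x i + 2 * ↑Real.pi * I * (k i : ℂ)) = kerTranslate x k := rfl
  rw [hfun]
  exact h

/-- **The kernel-translate class of a Case-A first failure inside its mate set is `{x}`.** [folklore] -/
theorem locusMates_inter_range_kerTranslate {x : Fin n → ℂ} (hx : x ∈ firstFailures n)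
    (hπ : Transcendental (IntermediateField.adjoin ℚ (range x ∪ range (cexp ∘ x))) (2 * ↑Real.pi * I)) :
    locusMates x ∩ Set.range (kerTranslate x) = {x} := by
  ext x'
  simp only [Set.mem_inter_iff, Set.mem_range, Set.mem_singleton_iff]
  constructor
  · rintro ⟨hx', k, rfl⟩
    have hk : k = 0 := kerTranslate_mem_locusMates_imp_eq_zero hx hπ hx'
    subst hk
    funext i
    simp [kerTranslate]
  · intro h
    rw [h]
    exact ⟨self_mem_locusMates x hx.1, 0, funext fun i => by simp [kerTranslate]⟩

/-- **RANK 2: a first failure OUTSIDE `acl(∅)²` has a trivial kernel-translate class** — either every coordinate of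
the rank-2 first failure `x` lies in `acl^{ℂ_exp}(∅)` (which is (S*) at `x`), or `2πi` is transcendental over `ℚ(x, eˣ)`
and then no `x + 2πi·k`, `k ≠ 0`, is a mate of `x`. [cite: KirbyMacintyreOnshuus2012, §2.3] -/
theorem rankTwo_mem_expAcl_or_kerTranslate_rigid : ∀ (x : Fin 2 → ℂ), x ∈ Summit.Schanuel.Schanuel.Cruxes.MinimalCounterexampleInAcl.KernelArithmeticSelection.firstFailures 2 → (∀ i, x i ∈ Summit.Schanuel.Schanuel.Theorems.AclSubsetLogFreeCore.Negative.expAcl) ∨ Summit.Schanuel.Schanuel.Cruxes.MinimalCounterexampleInAcl.KernelArithmeticSelection.locusMates x ∩ Set.range (Summit.Schanuel.Schanuel.Cruxes.MinimalCounterexampleInAcl.KernelArithmeticSelection.kerTranslate x) = {x} := by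
  intro x hx
  by_cases hπ : IsAlgebraic (IntermediateField.adjoin ℚ (range x ∪ range (cexp ∘ x))) (2 * ↑Real.pi * I)
  · exact Or.inl (firstFailure_two_mem_expAcl_of_isAlgebraic_twoPiI hx hπ)
  · exact Or.inr (locusMates_inter_range_kerTranslate hx hπ)

end Summit.Schanuel.Schanuel.Cruxes.MinimalCounterexampleInAcl.KernelArithmeticSelection

end
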